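import Mathlib
import Summits.ValiantsHypothesis.ValiantsHypothesis.Theorems.MatrixDescartes.Negative.MatrixDescartesFalseOfTropicalMonster

/-!
# `TropicalB` (stmt-ValiantsHypothesis-19771) — the EXCHANGE-SQUARE LAW: four terms in a parallelogram are never all dominant;
# hence, in ANY design, the dominant terms glue their halves across any column split in a `K₂,₂`-free pattern

Helper file for the crux `Theses.KPlusLogSqLaw.TropicalB` (`--supports stmt-ValiantsHypothesis-19771 --as helper`), cell
`pub-symmetroid`, seat val-sym-trop-p5 (g5, refuter-adjacent lane).  HONEST FRAMING: two structure theorems about the dominant terms of an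
ARBITRARY tropical design `(d, v, ε)` in the tree's vocabulary (`IsDominant`, `tropWeight`, `termSign` of
`…MatrixDescartesFalseOfTropicalMonster`); nothing here bears on `TropicalB` in its window, `WeakLifting`, `MatrixDescartes`
(stmt-ValiantsHypothesis-18050) or VP ≠ VNP.

* `not_dominant_square` — **EXCHANGE-SQUARE LAW.**  Let `p₁₁, p₁₂, p₂₁, p₂₂` be terms with `p₁₁ ≠ p₁₂`, `p₁₁ ≠ p₂₁`, `p₂₂ ≠ p₁₂`,
  `p₂₂ ≠ p₂₁` whose tropical weights satisfy the PARALLELOGRAM IDENTITY `w_θ(p₁₁) + w_θ(p₂₂) = w_θ(p₁₂) + w_θ(p₂₁)` for every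
  integer slope `θ` (equivalently: for the slopes and for the valuations).  Then the four terms are not all dominant (each at some
  integer slope).  Proof: each dominant corner beats the two adjacent corners (they are present, being dominant); the affine functions
  `w(p₁₁) − w(p₂₁) = w(p₁₂) − w(p₂₂)` and `w(p₁₁) − w(p₁₂) = w(p₂₁) − w(p₂₂)` would have to be positive at `{θ₁₁, θ₁₂}` resp.
  `{θ₁₁, θ₂₁}` and negative at the complementary corners, which two affine functions of one variable cannot do.  The two-term
  exchange inequality of the tree (`PathCoupling.slope_lt_of_exchange`, val-sym-trop-p5 g4) is the case where only two corners are
  dominant; the register form is `HardCorePair.not_K22` (this seat, p490541).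
* `not_dominant_split_square` — **SPLIT FORM, every design.**  For any set `S` of columns, four pairwise different terms obtained by
  gluing two `S`-halves `{L, L'}` with two `Sᶜ`-halves `{Q, Q'}` in all four ways (`p₁₁ = L ∪ Q`, `p₁₂ = L ∪ Q'`, `p₂₁ = L' ∪ Q`,
  `p₂₂ = L' ∪ Q'`: agreement of row and class on `S` resp. off `S`) satisfy the parallelogram identity, hence are never all dominant:
  along any dominant chain of any design, the bipartite «gluing graph» between the `S`-halves and the `Sᶜ`-halves that occur is
  `K₂,₂`-FREE (so, by Kővári–Sós–Turán, a chain of `n` terms uses `≳ n^{2/3}` distinct halves on each side of every split — the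
  counting is `HardCorePair.card_dominant_sq_le` and is not repeated here).
[folklore-level: the four-point exchange; Kővári–Sós–Turán 1954]
-/

set_option linter.dupNamespace false
set_option autoImplicit false

namespace Summit.ValiantsHypothesis.ValiantsHypothesis.Theorems.KPlusLogSqLaw.ExchangeSquare

open Summit.ValiantsHypothesis.ValiantsHypothesis.Theorems.MatrixDescartes.Negative
open Finset

variable {m K : ℕ} (d : Fin K → ℕ) (v ε : Fin m → Fin m → Fin K → ℤ)

/-- **EXCHANGE-SQUARE LAW**: four terms in a weight parallelogram are never all dominant. -/
theorem not_dominant_square {p₁₁ p₁₂ p₂₁ p₂₂ : Equiv.Perm (Fin m) × (Fin m → Fin K)} {θ₁ θ₂ θ₃ θ₄ : ℤ}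
    (h₁₂ : p₁₁ ≠ p₁₂) (h₁₃ : p₁₁ ≠ p₂₁) (h₄₂ : p₂₂ ≠ p₁₂) (h₄₃ : p₂₂ ≠ p₂₁)
    (hpar : ∀ θ : ℤ, tropWeight d v θ p₁₁ + tropWeight d v θ p₂₂ = tropWeight d v θ p₁₂ + tropWeight d v θ p₂₁)
    (d₁ : IsDominant d v ε θ₁ p₁₁) (d₂ : IsDominant d v ε θ₂ p₁₂) (d₃ : IsDominant d v ε θ₃ p₂₁)
    (d₄ : IsDominant d v ε θ₄ p₂₂) : False := by
  -- the eight comparisons between adjacent corners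
  have c1 := d₁.2 p₁₂ h₁₂.symm d₂.1
  have c2 := d₁.2 p₂₁ h₁₃.symm d₃.1
  have c3 := d₂.2 p₁₁ h₁₂ d₁.1
  have c4 := d₂.2 p₂₂ h₄₂ d₄.1
  have c5 := d₃.2 p₁₁ h₁₃ d₁.1
  have c6 := d₃.2 p₂₂ h₄₃ d₄.1
  have c7 := d₄.2 p₁₂ h₄₂.symm d₂.1
  have c8 := d₄.2 p₂₁ h₄₃.symm d₃.1
  have q0 := hpar 0
  have q1 := hpar 1
  simp only [tropWeight] at c1 c2 c3 c4 c5 c6 c7 c8 q0 q1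
  set S₁₁ := ∑ i, (d (p₁₁.2 i) : ℤ) with hS₁₁
  set S₁₂ := ∑ i, (d (p₁₂.2 i) : ℤ) with hS₁₂
  set S₂₁ := ∑ i, (d (p₂₁.2 i) : ℤ) with hS₂₁
  set S₂₂ := ∑ i, (d (p₂₂.2 i) : ℤ) with hS₂₂
  set V₁₁ := ∑ i, v (p₁₁.1 i) i (p₁₁.2 i) with hV₁₁
  set V₁₂ := ∑ i, v (p₁₂.1 i) i (p₁₂.2 i) with hV₁₂
  set V₂₁ := ∑ i, v (p₂₁.1 i) i (p₂₁.2 i) with hV₂₁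
  set V₂₂ := ∑ i, v (p₂₂.1 i) i (p₂₂.2 i) with hV₂₂
  -- the parallelogram identity for valuations (`θ = 0`) and slopes (`θ = 1`)
  have hV : V₁₁ + V₂₂ = V₁₂ + V₂₁ := by linarith
  have hS : S₁₁ + S₂₂ = S₁₂ + S₂₁ := by linarith
  -- `Δ(θ) = θ·a − c` with `a = S₁₁ − S₂₁ = S₁₂ − S₂₂`, `c = V₁₁ − V₂₁ = V₁₂ − V₂₂`: positive at `θ₁, θ₂`, negative at `θ₃, θ₄`
  set a := S₁₁ - S₂₁ with ha
  set c := V₁₁ - V₂₁ with hc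
  have F1 : θ₁ * a > c := by rw [ha, mul_sub]; linarith
  have F3 : θ₃ * a < c := by rw [ha, mul_sub]; linarith
  have F2 : θ₂ * a > c := by
    have e' : θ₂ * (S₁₁ + S₂₂) = θ₂ * (S₁₂ + S₂₁) := by rw [hS]
    rw [mul_add, mul_add] at e'
    rw [ha, mul_sub]; linarith
  have F4 : θ₄ * a < c := by
    have e' : θ₄ * (S₁₁ + S₂₂) = θ₄ * (S₁₂ + S₂₁) := by rw [hS]
    rw [mul_add, mul_add] at e'
    rw [ha, mul_sub]; linarith
  -- `Δ'(θ) = θ·a' − c'` with `a' = S₁₁ − S₁₂ = S₂₁ − S₂₂`, `c' = V₁₁ − V₁₂`: positive at `θ₁, θ₃`, negative at `θ₂, θ₄`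
  set a' := S₁₁ - S₁₂ with ha'
  set c' := V₁₁ - V₁₂ with hc'
  have G1 : θ₁ * a' > c' := by rw [ha', mul_sub]; linarith
  have G2 : θ₂ * a' < c' := by rw [ha', mul_sub]; linarith
  have G3 : θ₃ * a' > c' := by
    have e' : θ₃ * (S₁₁ + S₂₂) = θ₃ * (S₁₂ + S₂₁) := by rw [hS]
    rw [mul_add, mul_add] at e'
    rw [ha', mul_sub]; linarith
  have G4 : θ₄ * a' < c' := by
    have e' : θ₄ * (S₁₁ + S₂₂) = θ₄ * (S₁₂ + S₂₁) := by rw [hS]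
    rw [mul_add, mul_add] at e'
    rw [ha', mul_sub]; linarith
  clear c1 c2 c3 c4 c5 c6 c7 c8 q0 q1 hpar d₁ d₂ d₃ d₄
  -- sign bookkeeping
  rcases lt_trichotomy a 0 with hA | hA | hA
  · -- `a < 0`: `θ₁, θ₂ < θ₃, θ₄`
    have t23 : θ₂ < θ₃ := by
      by_contra h; push Not at h
      have := mul_le_mul_of_nonpos_right h hA.le; linarith
    have t14 : θ₁ < θ₄ := by
      by_contra h; push Not at h
      have := mul_le_mul_of_nonpos_right h hA.le; linarith
    rcases lt_trichotomy a' 0 with hA' | hA' | hA'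
    · have t32 : θ₃ < θ₂ := by
        by_contra h; push Not at h
        have := mul_le_mul_of_nonpos_right h hA'.le; linarith
      linarith
    · rw [hA'] at G1 G2; simp at G1 G2; linarith
    · have t41 : θ₄ < θ₁ := by
        by_contra h; push Not at h
        have := mul_le_mul_of_nonneg_right h hA'.le; linarith
      linarith
  · rw [hA] at F1 F3; simp at F1 F3; linarith
  · -- `a > 0`: `θ₃, θ₄ < θ₁, θ₂`
    have t32 : θ₃ < θ₂ := by
      by_contra h; push Not at h
      have := mul_le_mul_of_nonneg_right h hA.le; linarith
    have t41 : θ₄ < θ₁ := by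
      by_contra h; push Not at h
      have := mul_le_mul_of_nonneg_right h hA.le; linarith
    rcases lt_trichotomy a' 0 with hA' | hA' | hA'
    · have t14 : θ₁ < θ₄ := by
        by_contra h; push Not at h
        have := mul_le_mul_of_nonpos_right h hA'.le; linarith
      linarith
    · rw [hA'] at G1 G2; simp at G1 G2; linarith
    · have t23 : θ₂ < θ₃ := by
        by_contra h; push Not at h
        have := mul_le_mul_of_nonneg_right h hA'.le; linarith
      linarith

/-- two terms that agree (row and class) on every column are equal. -/
theorem term_eq_of_agree {p q : Equiv.Perm (Fin m) × (Fin m → Fin K)}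
    (h : ∀ i, p.1 i = q.1 i ∧ p.2 i = q.2 i) : p = q :=
  Prod.ext (Equiv.ext fun i => (h i).1) (funext fun i => (h i).2)

/-- gluing halves across a column split gives the parallelogram identity for any columnwise-additive statistic. -/
theorem sum_square_of_halves (S : Finset (Fin m)) (f : Fin m → Fin m → Fin K → ℤ)
    {p₁₁ p₁₂ p₂₁ p₂₂ : Equiv.Perm (Fin m) × (Fin m → Fin K)}
    (hL : ∀ i ∈ S, p₁₁.1 i = p₁₂.1 i ∧ p₁₁.2 i = p₁₂.2 i) (hL' : ∀ i ∈ S, p₂₁.1 i = p₂₂.1 i ∧ p₂₁.2 i = p₂₂.2 i)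
    (hR : ∀ i, i ∉ S → (p₁₁.1 i = p₂₁.1 i ∧ p₁₁.2 i = p₂₁.2 i))
    (hR' : ∀ i, i ∉ S → (p₁₂.1 i = p₂₂.1 i ∧ p₁₂.2 i = p₂₂.2 i)) :
    ∑ i, f (p₁₁.1 i) i (p₁₁.2 i) + ∑ i, f (p₂₂.1 i) i (p₂₂.2 i) =
      ∑ i, f (p₁₂.1 i) i (p₁₂.2 i) + ∑ i, f (p₂₁.1 i) i (p₂₁.2 i) := by
  classical
  rw [← Finset.sum_add_sum_compl S (fun i => f (p₁₁.1 i) i (p₁₁.2 i)),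
    ← Finset.sum_add_sum_compl S (fun i => f (p₂₂.1 i) i (p₂₂.2 i)),
    ← Finset.sum_add_sum_compl S (fun i => f (p₁₂.1 i) i (p₁₂.2 i)),
    ← Finset.sum_add_sum_compl S (fun i => f (p₂₁.1 i) i (p₂₁.2 i))]
  have e1 : ∑ i ∈ S, f (p₁₁.1 i) i (p₁₁.2 i) = ∑ i ∈ S, f (p₁₂.1 i) i (p₁₂.2 i) :=
    Finset.sum_congr rfl fun i hi => by rw [(hL i hi).1, (hL i hi).2]
  have e2 : ∑ i ∈ S, f (p₂₂.1 i) i (p₂₂.2 i) = ∑ i ∈ S, f (p₂₁.1 i) i (p₂₁.2 i) :=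
    Finset.sum_congr rfl fun i hi => by rw [(hL' i hi).1, (hL' i hi).2]
  have e3 : ∑ i ∈ Sᶜ, f (p₁₁.1 i) i (p₁₁.2 i) = ∑ i ∈ Sᶜ, f (p₂₁.1 i) i (p₂₁.2 i) :=
    Finset.sum_congr rfl fun i hi => by
      rw [(hR i (Finset.mem_compl.1 hi)).1, (hR i (Finset.mem_compl.1 hi)).2]
  have e4 : ∑ i ∈ Sᶜ, f (p₂₂.1 i) i (p₂₂.2 i) = ∑ i ∈ Sᶜ, f (p₁₂.1 i) i (p₁₂.2 i) :=
    Finset.sum_congr rfl fun i hi => by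
      rw [(hR' i (Finset.mem_compl.1 hi)).1, (hR' i (Finset.mem_compl.1 hi)).2]
  rw [e1, e2, e3, e4]
  ring

/-- **SPLIT FORM (every design): the gluing graph of halves across any column split is `K₂,₂`-free along dominant terms.**
For a column set `S` and terms `p₁₁ = L ∪ Q`, `p₁₂ = L ∪ Q'`, `p₂₁ = L' ∪ Q`, `p₂₂ = L' ∪ Q'` (agreement of row and class on `S`,
resp. off `S`) with `L ≠ L'` and `Q ≠ Q'` (i.e. `p₁₁ ≠ p₂₁`, `p₁₁ ≠ p₁₂`), the four terms are never all dominant. -/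
theorem not_dominant_split_square (S : Finset (Fin m)) {p₁₁ p₁₂ p₂₁ p₂₂ : Equiv.Perm (Fin m) × (Fin m → Fin K)}
    {θ₁ θ₂ θ₃ θ₄ : ℤ}
    (hL : ∀ i ∈ S, p₁₁.1 i = p₁₂.1 i ∧ p₁₁.2 i = p₁₂.2 i) (hL' : ∀ i ∈ S, p₂₁.1 i = p₂₂.1 i ∧ p₂₁.2 i = p₂₂.2 i)
    (hR : ∀ i, i ∉ S → (p₁₁.1 i = p₂₁.1 i ∧ p₁₁.2 i = p₂₁.2 i))
    (hR' : ∀ i, i ∉ S → (p₁₂.1 i = p₂₂.1 i ∧ p₁₂.2 i = p₂₂.2 i))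
    (h₁₂ : p₁₁ ≠ p₁₂) (h₁₃ : p₁₁ ≠ p₂₁)
    (d₁ : IsDominant d v ε θ₁ p₁₁) (d₂ : IsDominant d v ε θ₂ p₁₂) (d₃ : IsDominant d v ε θ₃ p₂₁)
    (d₄ : IsDominant d v ε θ₄ p₂₂) : False := by
  classical
  -- the two remaining inequalities follow from the gluing pattern
  have h₄₂ : p₂₂ ≠ p₁₂ := by
    intro he
    apply h₁₃
    refine term_eq_of_agree fun i => ?_
    by_cases hi : i ∈ S
    · have a := hL i hi; have b := hL' i hi
      rw [he] at b
      exact ⟨a.1.trans b.1.symm, a.2.trans b.2.symm⟩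
    · exact hR i hi
  have h₄₃ : p₂₂ ≠ p₂₁ := by
    intro he
    apply h₁₂
    refine term_eq_of_agree fun i => ?_
    by_cases hi : i ∈ S
    · exact hL i hi
    · have a := hR i hi; have b := hR' i hi
      rw [he] at b
      exact ⟨a.1.trans b.1.symm, a.2.trans b.2.symm⟩
  refine not_dominant_square d v ε h₁₂ h₁₃ h₄₂ h₄₃ (fun θ => ?_) d₁ d₂ d₃ d₄
  have hs := sum_square_of_halves S (fun _ _ l => (d l : ℤ)) hL hL' hR hR'
  have hv := sum_square_of_halves S v hL hL' hR hR'
  simp only [tropWeight]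
  linear_combination θ * hs - hv

end Summit.ValiantsHypothesis.ValiantsHypothesis.Theorems.KPlusLogSqLaw.ExchangeSquare
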